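import Mathlib.Algebra.MonoidAlgebra.MapDomain
import Mathlib.RepresentationTheory.Intertwining
import Literature.RepresentationTheory.LatticesInRationalRepresentation
import Literature.RepresentationTheory.FiniteGroups.StableLatticeReductionInvariantInt
import HarnessLib

/-!
# ℚ-isomorphic permutation modules have reductions mod `p` with the same additive invariants
# (Serre, *Linear Representations of Finite Groups*, §15.2 Thm. 32 for permutation lattices;
# Milne, *Arithmetic Duality Theorems*, I Lemma 2.12)

Topic `RepresentationTheory/FiniteGroups`; namespace `Literature.RepresentationTheory.FiniteGroups`
(sub-namespace `PermutationLattice`).  THEOREMS ONLY (no definition, no named fact, no `sorry`,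
no instance).  The link between the `G`-SET side of Artin's induction theorem
(`ArtinGassmannPermutationSets`: a `ℚ[G]`-isomorphism `ℚ[A] ≅ ℚ[B]` of permutation modules) and the
`𝔽_p[G]`-MODULE side used in Tate's Euler–Poincaré characteristic argument: for every invariant `ψ` of
`ℤ[G]`-modules additive on short exact sequences with finite `p`-torsion middle term (the binders of
`StableLatticeReductionInvariantInt`),

  `ℚ[A] ≅ ℚ[B]` as `ℚ[G]`-modules ⟹ `ψ (ℤ[A]/p) = ψ (ℤ[B]/p)`

(`additive_reduction_ofMulAction_eq_of_ratEquiv`).  Proof: the tree's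
`LatticesInRationalRepresentation.exists_equivariant_hom_of_span_eq_top` (Cassels–Fröhlich IV §8 /
Serre §15.1: two `G`-lattices spanning the same `ℚ[G]`-module are commensurable) applied to
`ℤ[A] → ℚ[A] ≅ ℚ[B] ← ℤ[B]` gives an injective `G`-map `j : ℤ[A] → ℤ[B]` with image of finite index;
then Serre's Thm. 32 over `ℤ` (`StableLatticeReduction.Int.additive_reduction_eq_of_finite_index`).
Here `ℤ[A] = Representation.ofMulAction ℤ G A` on Mathlib's `MonoidAlgebra ℤ A`, and the coefficient
extension `ℤ[A] → ℚ[A]` is `MonoidAlgebra.map (Int.castAddHom ℚ)`.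

Written for the road memo `TATE-EPC-TC-ROAD` (evidence #54 on stmt-BirchSwinnertonDyer-19032),
brick B3b-2.

## References
* J.-P. Serre, *Linear Representations of Finite Groups*, GTM 42 (1977), §15.1–§15.2, Thm. 32.
  [SerreLinearRepresentations1977]
* J. S. Milne, *Arithmetic Duality Theorems*, 2nd ed. (2006), I Lemmas 2.10, 2.12. [MilneADT2006]
-/

namespace Literature.RepresentationTheory.FiniteGroups

namespace PermutationLattice

open Function LinearMap Submodule MonoidAlgebra StableLatticeReduction
open scoped Pointwise MonoidAlgebra

variable {G : Type} [Group G] {A : Type*} [AddCommGroup A]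

/-! ### §1. The coefficient extension `ℤ[X] → ℚ[X]` -/

section Cast

variable (X : Type) [MulAction G X]

/-- The coefficient extension `ℤ[X] → ℚ[X]` is additive, so `ℤ`-linear; we use it through
`AddMonoidHom.toIntLinearMap` of this bundled map. [cite: SerreLinearRepresentations1977, §15.1] -/
theorem map_intCast_add (x y : MonoidAlgebra ℤ X) :
    MonoidAlgebra.map (M := X) (Int.castAddHom ℚ) (x + y) =
      MonoidAlgebra.map (M := X) (Int.castAddHom ℚ) x + MonoidAlgebra.map (M := X) (Int.castAddHom ℚ) y :=
  MonoidAlgebra.map_add _ _ _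

/-- `ℤ[X] → ℚ[X]` is `G`-equivariant for the permutation actions.
[cite: SerreLinearRepresentations1977, §15.1] -/
theorem map_intCast_ofMulAction (g : G) (x : MonoidAlgebra ℤ X) :
    MonoidAlgebra.map (M := X) (Int.castAddHom ℚ) (Representation.ofMulAction ℤ G X g x) =
      Representation.ofMulAction ℚ G X g (MonoidAlgebra.map (M := X) (Int.castAddHom ℚ) x) := by
  induction x using MonoidAlgebra.induction_linear with
  | zero => rw [map_zero, MonoidAlgebra.map_zero, map_zero]
  | add x y hx hy => rw [map_add, MonoidAlgebra.map_add, hx, hy, MonoidAlgebra.map_add, map_add]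
  | single m r =>
    rw [Representation.ofMulAction_single, MonoidAlgebra.map_single, MonoidAlgebra.map_single,
      Representation.ofMulAction_single]

/-- `ℤ[X] → ℚ[X]` is injective. [cite: SerreLinearRepresentations1977, §15.1] -/
theorem map_intCast_injective :
    Injective (MonoidAlgebra.map (M := X) (Int.castAddHom ℚ)) :=
  MonoidAlgebra.map_injective _ (fun a b h => by simpa using h)

/-- The image of `ℤ[X]` spans `ℚ[X]` over `ℚ`. [cite: SerreLinearRepresentations1977, §15.1] -/
theorem span_range_map_intCast_eq_top :
    Submodule.span ℚ (Set.range (MonoidAlgebra.map (M := X) (Int.castAddHom ℚ))) = ⊤ := by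
  have key : ∀ x : MonoidAlgebra ℚ X,
      x ∈ Submodule.span ℚ (Set.range (MonoidAlgebra.map (M := X) (Int.castAddHom ℚ))) := by
    intro x
    induction x using MonoidAlgebra.induction_linear with
    | zero => exact Submodule.zero_mem _
    | add x y hx hy => exact Submodule.add_mem _ hx hy
    | single m r =>
      have h1 : MonoidAlgebra.single m r = r • MonoidAlgebra.single m (1 : ℚ) := by
        rw [MonoidAlgebra.smul_single', mul_one]
      rw [h1]
      refine Submodule.smul_mem _ r (Submodule.subset_span ⟨MonoidAlgebra.single m 1, ?_⟩)
      rw [MonoidAlgebra.map_single]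
      rfl
  exact eq_top_iff.2 fun x _ => key x

end Cast

/-! ### §2. The theorem -/

section Reduction

variable (ψ : ∀ ⦃Y : Type⦄ [AddCommGroup Y] [Module ℤ Y], Representation ℤ G Y → A) {p : ℕ}
  (hψ : ∀ ⦃X Y Z : Type⦄ [AddCommGroup X] [Module ℤ X] [AddCommGroup Y] [Module ℤ Y]
    [AddCommGroup Z] [Module ℤ Z] (ρX : Representation ℤ G X) (ρY : Representation ℤ G Y)
    (ρZ : Representation ℤ G Z) (f : X →ₗ[ℤ] Y) (g : Y →ₗ[ℤ] Z),
    (∀ s x, f (ρX s x) = ρY s (f x)) → (∀ s y, g (ρY s y) = ρZ s (g y)) →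
    Injective f → Surjective g → LinearMap.range f = LinearMap.ker g → Finite Y →
    (∀ y : Y, (p : ℤ) • y = 0) → ψ ρY = ψ ρX + ψ ρZ)
include hψ

omit hψ in
/-- `ℤ[X]` has no `p`-torsion. [cite: SerreLinearRepresentations1977, §15.1] -/
theorem smul_eq_zero_imp_monoidAlgebra [hp : Fact p.Prime] (X : Type) (x : MonoidAlgebra ℤ X)
    (h : (p : ℤ) • x = 0) : x = 0 :=
  (smul_eq_zero.1 h).resolve_left (by exact_mod_cast hp.out.ne_zero)

omit hψ in
/-- `ℤ[X]/pℤ[X]` is finite for `X` finite. [cite: SerreLinearRepresentations1977, §15.2] -/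
theorem finite_monoidAlgebra_quotient_smul_top [hp : Fact p.Prime] (X : Type) [Finite X] :
    Finite (MonoidAlgebra ℤ X ⧸ ((p : ℤ) • ⊤ : Submodule ℤ (MonoidAlgebra ℤ X))) := by
  haveI : Module.Finite ℤ (MonoidAlgebra ℤ X ⧸ ((p : ℤ) • ⊤ : Submodule ℤ (MonoidAlgebra ℤ X))) :=
    Module.Finite.quotient ℤ _
  refine Module.finite_of_fg_torsion _ fun z => ?_
  refine ⟨⟨(p : ℤ), mem_nonZeroDivisors_of_ne_zero (by exact_mod_cast hp.out.ne_zero)⟩, ?_⟩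
  rw [Submonoid.mk_smul]
  exact Int.smul_quotient_smul_top_eq_zero (p : ℤ) z

/-- **`ℚ[A] ≅ ℚ[B]` ⟹ `ψ (ℤ[A]/p) = ψ (ℤ[B]/p)`** for every invariant `ψ` of `ℤ[G]`-modules additive
on short exact sequences with finite `p`-torsion middle term: a `ℚ[G]`-isomorphism of the
permutation modules of two finite `G`-sets makes the lattices `ℤ[A]`, `ℤ[B]` commensurable
(`exists_equivariant_hom_of_span_eq_top`), and commensurable stable lattices have reductions mod `p`
with the same composition data (Serre's Thm. 32, `additive_reduction_eq_of_finite_index`).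
[cite: SerreLinearRepresentations1977, §15.2 Thm. 32] [cite: MilneADT2006, I Lemmas 2.10 and 2.12] -/
theorem additive_reduction_ofMulAction_eq_of_ratEquiv [hp : Fact p.Prime] {X₁ X₂ : Type}
    [Fintype X₁] [Fintype X₂] [MulAction G X₁] [MulAction G X₂]
    (e : Representation.Equiv (Representation.ofMulAction ℚ G X₁) (Representation.ofMulAction ℚ G X₂)) :
    ψ ((Representation.ofMulAction ℤ G X₁).quotient ((p : ℤ) • ⊤)
        (smul_top_le_comap (Representation.ofMulAction ℤ G X₁) (p : ℤ))) =
      ψ ((Representation.ofMulAction ℤ G X₂).quotient ((p : ℤ) • ⊤)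
        (smul_top_le_comap (Representation.ofMulAction ℤ G X₂) (p : ℤ))) := by
  classical
  -- the `ℤ`-linear coefficient extensions
  let c₁ : MonoidAlgebra ℤ X₁ →+ MonoidAlgebra ℚ X₁ :=
    { toFun := MonoidAlgebra.map (M := X₁) (Int.castAddHom ℚ)
      map_zero' := MonoidAlgebra.map_zero _
      map_add' := map_intCast_add X₁ }
  let c₂ : MonoidAlgebra ℤ X₂ →+ MonoidAlgebra ℚ X₂ :=
    { toFun := MonoidAlgebra.map (M := X₂) (Int.castAddHom ℚ)
      map_zero' := MonoidAlgebra.map_zero _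
      map_add' := map_intCast_add X₂ }
  let i₂ : MonoidAlgebra ℤ X₂ →ₗ[ℤ] MonoidAlgebra ℚ X₂ := c₂.toIntLinearMap
  let i₁ : MonoidAlgebra ℤ X₁ →ₗ[ℤ] MonoidAlgebra ℚ X₂ :=
    (e.toLinearMap.restrictScalars ℤ) ∘ₗ c₁.toIntLinearMap
  have hi₁v : ∀ x, i₁ x = e (MonoidAlgebra.map (M := X₁) (Int.castAddHom ℚ) x) := fun x => rfl
  have hi₂v : ∀ x, i₂ x = MonoidAlgebra.map (M := X₂) (Int.castAddHom ℚ) x := fun x => rfl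
  have h₂ : ∀ s x, i₂ (Representation.ofMulAction ℤ G X₂ s x) =
      Representation.ofMulAction ℚ G X₂ s (i₂ x) := fun s x => by
    rw [hi₂v, hi₂v, map_intCast_ofMulAction]
  have h₁ : ∀ s x, i₁ (Representation.ofMulAction ℤ G X₁ s x) =
      Representation.ofMulAction ℚ G X₂ s (i₁ x) := fun s x => by
    rw [hi₁v, hi₁v, map_intCast_ofMulAction]
    exact LinearMap.congr_fun (e.toIntertwiningMap.isIntertwining' s) _
  have hi₂ : Injective i₂ := map_intCast_injective X₂
  have hi₁ : Injective i₁ := e.injective.comp (map_intCast_injective X₁)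
  have hsp₂ : Submodule.span ℚ (Set.range i₂) = ⊤ := span_range_map_intCast_eq_top X₂
  have hsp₁ : Submodule.span ℚ (Set.range i₁) = ⊤ := by
    have hr : Set.range i₁ = e.toLinearMap '' Set.range (MonoidAlgebra.map (M := X₁) (Int.castAddHom ℚ)) := by
      ext v
      simp only [Set.mem_range, Set.mem_image, hi₁v, exists_exists_eq_and]
      rfl
    rw [hr, Submodule.span_image, span_range_map_intCast_eq_top X₁, Submodule.map_top,
      LinearMap.range_eq_top]
    exact e.surjective
  -- commensurability: `j : ℤ[X₁] → ℤ[X₂]`, equivariant, injective, of finite index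
  obtain ⟨N, j, hN, hj, hjG, hfin⟩ :=
    Literature.RepresentationTheory.exists_equivariant_hom_of_span_eq_top
      (Representation.ofMulAction ℚ G X₂) (Representation.ofMulAction ℤ G X₁)
      (Representation.ofMulAction ℤ G X₂) i₁ i₂ h₁ h₂ hi₂ hsp₁ hsp₂
  have hjinj : Injective j := by
    rw [← LinearMap.ker_eq_bot, Literature.RepresentationTheory.ker_eq_ker_of_comp_eq_smul i₁ i₂ hi₂ j hN hj,
      LinearMap.ker_eq_bot]
    exact hi₁
  haveI := hfin
  haveI := finite_monoidAlgebra_quotient_smul_top (p := p) X₂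
  have hstab : ∀ s, LinearMap.range j ≤ (LinearMap.range j).comap (Representation.ofMulAction ℤ G X₂ s) :=
    range_le_comap_of_comm _ _ j hjG
  -- Serre Thm. 32 over `ℤ`: `ψ (ℤ[X₂]/p) = ψ (j(ℤ[X₁])/p)`
  have hβ := Int.additive_reduction_eq_of_finite_index ψ hψ (Representation.ofMulAction ℤ G X₂)
    (smul_eq_zero_imp_monoidAlgebra (p := p) X₂) (LinearMap.range j) hstab
  -- `j(ℤ[X₁]) ≅ ℤ[X₁]`
  haveI := Int.finite_quotient_smul_top_of_le (p : ℤ) (LinearMap.range j)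
    (Λ := MonoidAlgebra ℤ X₂)
  have hα := Int.additive_reduction_eq_of_linearEquiv ψ hψ (Representation.ofMulAction ℤ G X₁)
    ((Representation.ofMulAction ℤ G X₂).subrepresentation (LinearMap.range j) hstab)
    (LinearEquiv.ofInjective j hjinj) (fun s x => Subtype.ext (hjG s x))
  rw [hα, hβ]

end Reduction

end PermutationLattice

end Literature.RepresentationTheory.FiniteGroups
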